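import Mathlib
import Literature.NumberTheory.Transcendental.BlochWignerFiveTerm
import HarnessLib

/-!
# The Bloch–Wigner dilogarithm on the unit circle and the `√7` arctangent integral

Support file (everything PROVED; theorems only) for the discharge of
`Literature.NumberTheory.Transcendental.BaileyEtAl2010_sqrt7_identity`.

* `hasDerivAt_blochWignerDilog_circle` — `d/dθ D(e^{iθ}) = −log|1 − e^{iθ}| = −log|2 sin(θ/2)|`;
* `integral_log_abs_two_sin_half` — the Clausen integral
  `∫₀^θ log|2 sin(t/2)| dt = −D(e^{iθ})` for `θ ∈ (−2π, 2π)` (Bailey et al. 2010, §5, eq. (15):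
  `Cl₂(θ) = −∫₀^θ log|2 sin σ| dσ`, with `∫₀^π log(2 sin(t/2)) dt = 0` from Mathlib's
  `∫₀^{π/2} log sin = −(π/2) log 2`);
* `integral_log_tan_sqrt_seven` — the "tedious manipulation" of loc. cit. p. 8:
  `∫_{π/3}^{π/2} log|(tan t + √7)/(tan t − √7)| dt = (3D(u) − 3D(u²) + D(u³))/6`,
  `u = e^{iα}`, `α = 2 arctan √7`, via `(tan t + tan φ)/(tan t − tan φ) = sin(t+φ)/sin(t−φ)`,
  the Clausen integral, and the duplication / triplication relations of `D`;
* `exp_two_arctan_sqrt_seven_mul_I` — `e^{iα} = (−3 + i√7)/4`.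

References: Bailey–Borwein–Broadhurst–Zudilin, Contemp. Math. 517 (2010), §5 [BaileyEtAl2010];
D. Zagier, *The dilogarithm function* (2007), Ch. I §3. All statements are [folklore] unless
cited.
-/

noncomputable section

open MeasureTheory intervalIntegral Set Filter
open scoped Real Topology Interval ComplexConjugate

namespace Literature.NumberTheory.Transcendental

/-! ### The derivative of `θ ↦ D(e^{iθ})` -/

/-- `‖1 − e^{iθ}‖ = |2 sin(θ/2)|`. [folklore] -/
theorem norm_one_sub_exp_mul_I (θ : ℝ) :
    ‖1 - Complex.exp (θ * Complex.I)‖ = |2 * Real.sin (θ / 2)| := by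
  rw [norm_sub_rev, mul_comm, Complex.norm_exp_I_mul_ofReal_sub_one, Real.norm_eq_abs]

/-- `e^{iθ} ≠ 1` when `sin(θ/2) ≠ 0`. [folklore] -/
theorem exp_mul_I_ne_one {θ : ℝ} (h : Real.sin (θ / 2) ≠ 0) : Complex.exp (θ * Complex.I) ≠ 1 := by
  intro h1
  have := norm_one_sub_exp_mul_I θ
  rw [h1, sub_self, norm_zero] at this
  have : 2 * Real.sin (θ / 2) = 0 := abs_eq_zero.1 this.symm
  exact h (by linarith)

/-- **`d/dθ D(e^{iθ}) = −log|1 − e^{iθ}|`** away from `e^{iθ} = 1` (from `dD = Im(c(z) dz)` with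
`log|e^{iθ}| = 0`). [folklore] -/
theorem hasDerivAt_blochWignerDilog_circle {θ : ℝ} (h1 : Complex.exp (θ * Complex.I) ≠ 1) :
    HasDerivAt (fun t : ℝ => blochWignerDilog (Complex.exp (t * Complex.I)))
      (-Real.log ‖1 - Complex.exp (θ * Complex.I)‖) θ := by
  set w := Complex.exp (θ * Complex.I) with hw
  have hw0 : w ≠ 0 := Complex.exp_ne_zero _
  have hwn : ‖w‖ = 1 := Complex.norm_exp_ofReal_mul_I θ
  have hγ : HasDerivAt (fun t : ℝ => Complex.exp (t * Complex.I)) (w * (1 * Complex.I)) θ := by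
    have : HasDerivAt (fun t : ℝ => (t : ℂ) * Complex.I) (1 * Complex.I) θ :=
      (hasDerivAt_id θ).ofReal_comp.mul_const Complex.I
    exact this.cexp
  have hcomp := (hasFDerivAt_blochWignerDilog hw0 h1).comp_hasDerivAt θ hγ
  refine hcomp.congr_deriv ?_
  rw [imCLM_comp_smul_apply, hwn, Real.log_one]
  have : (-((Real.log ‖1 - w‖ : ℝ) : ℂ) / w - ((0 : ℝ) : ℂ) / (1 - w)) * (w * (1 * Complex.I)) =
      -((Real.log ‖1 - w‖ : ℝ) : ℂ) * Complex.I := by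
    field_simp
    push_cast
    ring
  rw [this]
  simp

/-! ### Integrability of `log|2 sin(ct + d)|` -/

/-- `t ↦ log|2 sin(ct + d)|` is interval-integrable on every interval (a real-analytic argument of
`log`; Mathlib's `MeromorphicOn.intervalIntegrable_log`). [folklore] -/
theorem intervalIntegrable_log_abs_two_sin (c d a b : ℝ) :
    IntervalIntegrable (fun t : ℝ => Real.log |2 * Real.sin (c * t + d)|) volume a b := by
  have han : AnalyticOnNhd ℝ (fun t : ℝ => 2 * Real.sin (c * t + d)) univ := by
    have h1 : AnalyticOnNhd ℝ (fun t : ℝ => c * t + d) univ :=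
      (analyticOnNhd_const.mul analyticOnNhd_id).add analyticOnNhd_const
    exact analyticOnNhd_const.mul (Real.analyticOnNhd_sin.comp h1 (mapsTo_univ _ _))
  have hmer : MeromorphicOn (fun t : ℝ => 2 * Real.sin (c * t + d)) (uIcc a b) :=
    (han.mono (subset_univ _)).meromorphicOn
  have hfun : (fun t : ℝ => Real.log |2 * Real.sin (c * t + d)|) =
      Real.log ∘ fun t : ℝ => 2 * Real.sin (c * t + d) := by
    funext t; simp only [Function.comp_apply, Real.log_abs]
  rw [hfun]
  exact hmer.intervalIntegrable_log

/-- `t ↦ log|2 sin(t/2)|` is interval-integrable on every interval. [folklore] -/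
theorem intervalIntegrable_log_abs_two_sin_half (a b : ℝ) :
    IntervalIntegrable (fun t : ℝ => Real.log |2 * Real.sin (t / 2)|) volume a b := by
  simpa [div_eq_inv_mul] using intervalIntegrable_log_abs_two_sin 2⁻¹ 0 a b

/-! ### The Clausen integral `∫₀^θ log|2 sin(t/2)| dt = −D(e^{iθ})` -/

/-- FTC on a subinterval of `(0, 2π)`: `D(e^{ib}) − D(e^{ia}) = −∫_a^b log|2 sin(t/2)| dt`.
[folklore] -/
theorem blochWignerDilog_exp_sub {a b : ℝ} (ha : 0 < a) (hab : a ≤ b) (hb : b < 2 * π) :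
    blochWignerDilog (Complex.exp (b * Complex.I)) - blochWignerDilog (Complex.exp (a * Complex.I)) =
      -∫ t in a..b, Real.log |2 * Real.sin (t / 2)| := by
  have hsin : ∀ t ∈ Icc a b, Real.sin (t / 2) ≠ 0 := fun t ht =>
    (Real.sin_pos_of_pos_of_lt_pi (by linarith [ht.1]) (by linarith [ht.2])).ne'
  have hderiv : ∀ t ∈ uIcc a b, HasDerivAt (fun t : ℝ => blochWignerDilog
      (Complex.exp (t * Complex.I))) (-Real.log |2 * Real.sin (t / 2)|) t := by
    intro t ht
    rw [uIcc_of_le hab] at ht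
    have := hasDerivAt_blochWignerDilog_circle (exp_mul_I_ne_one (hsin t ht))
    rwa [norm_one_sub_exp_mul_I] at this
  have hcont : ContinuousOn (fun t : ℝ => -Real.log |2 * Real.sin (t / 2)|) (uIcc a b) := by
    rw [uIcc_of_le hab]
    refine ContinuousOn.neg (ContinuousOn.log (by fun_prop) fun t ht => ?_)
    exact abs_ne_zero.2 (mul_ne_zero two_ne_zero (hsin t ht))
  rw [← integral_eq_sub_of_hasDerivAt hderiv hcont.intervalIntegrable,
    intervalIntegral.integral_neg]

/-- `∫₀^π log|2 sin(t/2)| dt = 0` (i.e. `Cl₂(π) = 0`), from Mathlib's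
`∫₀^{π/2} log(sin x) dx = −(π/2) log 2`. [folklore] -/
theorem integral_log_abs_two_sin_half_zero_pi :
    ∫ t in (0 : ℝ)..π, Real.log |2 * Real.sin (t / 2)| = 0 := by
  have h1 : ∫ t in (0 : ℝ)..π, Real.log |2 * Real.sin (t / 2)| =
      2 * ∫ s in (0 : ℝ)..π / 2, Real.log |2 * Real.sin s| := by
    have := intervalIntegral.integral_comp_div (a := (0 : ℝ)) (b := π)
      (fun s : ℝ => Real.log |2 * Real.sin s|) (two_ne_zero)
    simpa using this
  have h2 : ∫ s in (0 : ℝ)..π / 2, Real.log |2 * Real.sin s| =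
      ∫ s in (0 : ℝ)..π / 2, (Real.log 2 + Real.log (Real.sin s)) := by
    refine intervalIntegral.integral_congr_ae (Filter.Eventually.of_forall fun s hs => ?_)
    rw [uIoc_of_le (by positivity)] at hs
    have hpos : 0 < Real.sin s := Real.sin_pos_of_pos_of_lt_pi hs.1 (by linarith [hs.2, Real.pi_pos])
    rw [abs_of_pos (by positivity), Real.log_mul two_ne_zero hpos.ne']
  have h3 : ∫ s in (0 : ℝ)..π / 2, (Real.log 2 + Real.log (Real.sin s)) =
      (π / 2) * Real.log 2 + -Real.log 2 * π / 2 := by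
    rw [intervalIntegral.integral_add intervalIntegrable_const, intervalIntegral.integral_const,
      integral_log_sin_zero_pi_div_two]
    · simp
    · exact (intervalIntegrable_log_sin (a := 0) (b := π / 2))
  rw [h1, h2, h3]
  ring

/-- **The Clausen integral on `(0, 2π)`**: `∫₀^θ log|2 sin(t/2)| dt = −D(e^{iθ})`
(Bailey et al. 2010, §5, eq. (15): `Cl₂(θ) = −∫₀^θ log|2 sin σ|dσ … for 0 ≤ θ < 2π`, with
`D(e^{iθ}) = Cl₂(θ)`). [cite: BaileyEtAl2010, §5 eq. (15)] -/
theorem integral_log_abs_two_sin_half_of_pos {θ : ℝ} (h0 : 0 < θ) (h2 : θ < 2 * π) :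
    ∫ t in (0 : ℝ)..θ, Real.log |2 * Real.sin (t / 2)| =
      -blochWignerDilog (Complex.exp (θ * Complex.I)) := by
  have hint := intervalIntegrable_log_abs_two_sin_half
  have hπ : blochWignerDilog (Complex.exp (π * Complex.I)) = 0 := by
    rw [Complex.exp_pi_mul_I, show (-1 : ℂ) = ((-1 : ℝ) : ℂ) by norm_num, blochWignerDilog_ofReal]
  have h0π := integral_log_abs_two_sin_half_zero_pi
  rcases le_or_gt θ π with hle | hlt
  · have := blochWignerDilog_exp_sub h0 hle (by linarith [Real.pi_pos])
    have hadd := integral_add_adjacent_intervals (hint 0 θ) (hint θ π)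
    rw [hπ, zero_sub] at this
    linarith
  · have := blochWignerDilog_exp_sub Real.pi_pos hlt.le h2
    have hadd := integral_add_adjacent_intervals (hint 0 π) (hint π θ)
    rw [hπ, sub_zero] at this
    linarith

/-- **The Clausen integral on `(−2π, 2π)`**: `∫₀^θ log|2 sin(t/2)| dt = −D(e^{iθ})` (the
integrand is even, `D(e^{−iθ}) = −D(e^{iθ})`, and both sides vanish at `θ = 0`). [folklore] -/
theorem integral_log_abs_two_sin_half {θ : ℝ} (h1 : -(2 * π) < θ) (h2 : θ < 2 * π) :
    ∫ t in (0 : ℝ)..θ, Real.log |2 * Real.sin (t / 2)| =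
      -blochWignerDilog (Complex.exp (θ * Complex.I)) := by
  rcases lt_trichotomy θ 0 with hlt | rfl | hgt
  · have hneg := integral_log_abs_two_sin_half_of_pos (neg_pos.2 hlt) (by linarith)
    have hev : ∫ t in (0 : ℝ)..θ, Real.log |2 * Real.sin (t / 2)| =
        -∫ t in (0 : ℝ)..-θ, Real.log |2 * Real.sin (t / 2)| := by
      have := intervalIntegral.integral_comp_neg (a := (0 : ℝ)) (b := -θ)
        (fun t : ℝ => Real.log |2 * Real.sin (t / 2)|)
      simp only [neg_neg, neg_zero] at this
      rw [intervalIntegral.integral_symm θ 0, ← this]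
      congr 1
      refine intervalIntegral.integral_congr fun t _ => ?_
      simp only [neg_div, Real.sin_neg, mul_neg, abs_neg]
    rw [hev, hneg, neg_neg, show ((-θ : ℝ) : ℂ) * Complex.I = conj ((θ : ℂ) * Complex.I) by
      simp [Complex.conj_ofReal], Complex.exp_conj, blochWignerDilog_conj']
  · simp
  · exact integral_log_abs_two_sin_half_of_pos hgt h2

/-- `∫_a^b log|2 sin(t/2)| dt = D(e^{ia}) − D(e^{ib})` for `a, b ∈ (−2π, 2π)`. [folklore] -/
theorem integral_log_abs_two_sin_half_eq_sub {a b : ℝ} (ha1 : -(2 * π) < a) (ha2 : a < 2 * π)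
    (hb1 : -(2 * π) < b) (hb2 : b < 2 * π) :
    ∫ t in a..b, Real.log |2 * Real.sin (t / 2)| =
      blochWignerDilog (Complex.exp (a * Complex.I)) -
        blochWignerDilog (Complex.exp (b * Complex.I)) := by
  have hint := intervalIntegrable_log_abs_two_sin_half
  rw [← integral_interval_sub_left (hint 0 b) (hint 0 a), integral_log_abs_two_sin_half hb1 hb2,
    integral_log_abs_two_sin_half ha1 ha2]
  ring

/-! ### The arctangent integral of Bailey–Borwein–Broadhurst–Zudilin -/

/-- `π/3 < arctan √7 < π/2`. [folklore] -/
theorem arctan_sqrt_seven_bounds : π / 3 < Real.arctan (Real.sqrt 7) ∧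
    Real.arctan (Real.sqrt 7) < π / 2 := by
  refine ⟨?_, Real.arctan_lt_pi_div_two _⟩
  have h3 : Real.arctan (Real.sqrt 3) = π / 3 := by
    rw [← Real.tan_pi_div_three]
    exact Real.arctan_tan (by linarith [Real.pi_pos]) (by linarith [Real.pi_pos])
  rw [← h3]
  exact Real.arctan_strictMono (Real.sqrt_lt_sqrt (by norm_num) (by norm_num))

/-- `cos(2 arctan √7) = −3/4` and `sin(2 arctan √7) = √7/4`. [folklore] -/
theorem cos_sin_two_arctan_sqrt_seven :
    Real.cos (2 * Real.arctan (Real.sqrt 7)) = -3 / 4 ∧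
      Real.sin (2 * Real.arctan (Real.sqrt 7)) = Real.sqrt 7 / 4 := by
  have h8 : Real.sqrt (1 + Real.sqrt 7 ^ 2) = 2 * Real.sqrt 2 := by
    rw [Real.sq_sqrt (by norm_num), show (1 : ℝ) + 7 = 2 ^ 2 * 2 by norm_num,
      Real.sqrt_mul (by norm_num), Real.sqrt_sq (by norm_num)]
  have hc : Real.cos (Real.arctan (Real.sqrt 7)) = 1 / (2 * Real.sqrt 2) := by
    rw [Real.cos_arctan, h8]
  have hs : Real.sin (Real.arctan (Real.sqrt 7)) = Real.sqrt 7 / (2 * Real.sqrt 2) := by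
    rw [Real.sin_arctan, h8]
  have h2 : Real.sqrt 2 ^ 2 = 2 := Real.sq_sqrt (by norm_num)
  constructor
  · rw [Real.cos_two_mul, hc]
    field_simp
    rw [h2]; norm_num
  · rw [Real.sin_two_mul, hs, hc]
    field_simp
    rw [h2]
    norm_num

/-- `e^{iα} = (−3 + i√7)/4` for `α = 2 arctan √7`. [folklore] -/
theorem exp_two_arctan_sqrt_seven_mul_I :
    Complex.exp ((2 * Real.arctan (Real.sqrt 7) : ℝ) * Complex.I) =
      ⟨-3 / 4, Real.sqrt 7 / 4⟩ := by
  obtain ⟨hc, hs⟩ := cos_sin_two_arctan_sqrt_seven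
  apply Complex.ext
  · rw [Complex.exp_ofReal_mul_I_re, hc]
  · rw [Complex.exp_ofReal_mul_I_im, hs]

/-- The trigonometric identity `(tan t + tan φ)/(tan t − tan φ) = sin(t + φ)/sin(t − φ)` for
`cos t, cos φ ≠ 0`. [folklore] -/
theorem tan_add_div_tan_sub {t φ : ℝ} (ht : Real.cos t ≠ 0) (hφ : Real.cos φ ≠ 0) :
    (Real.tan t + Real.tan φ) / (Real.tan t - Real.tan φ) =
      Real.sin (t + φ) / Real.sin (t - φ) := by
  rw [Real.tan_eq_sin_div_cos, Real.tan_eq_sin_div_cos, Real.sin_add, Real.sin_sub]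
  rw [div_add_div _ _ ht hφ, div_sub_div _ _ ht hφ, div_div_div_cancel_right₀ (mul_ne_zero ht hφ)]

/-- Pointwise form of the integrand: for `t ∈ (π/3, π/2)`, `t ≠ arctan √7`,
`log|(tan t + √7)/(tan t − √7)| = log|2 sin(t + φ)| − log|2 sin(t − φ)|`, `φ = arctan √7`.
[folklore] -/
theorem log_tan_sqrt_seven_eq {t : ℝ} (ht1 : π / 3 < t) (ht2 : t < π / 2)
    (htφ : t ≠ Real.arctan (Real.sqrt 7)) :
    Real.log |(Real.tan t + Real.sqrt 7) / (Real.tan t - Real.sqrt 7)| =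
      Real.log |2 * Real.sin (t + Real.arctan (Real.sqrt 7))| -
        Real.log |2 * Real.sin (t - Real.arctan (Real.sqrt 7))| := by
  set φ := Real.arctan (Real.sqrt 7) with hφ
  obtain ⟨hφ1, hφ2⟩ := arctan_sqrt_seven_bounds
  have hcos : Real.cos t ≠ 0 :=
    (Real.cos_pos_of_mem_Ioo ⟨by linarith [Real.pi_pos], ht2⟩).ne'
  have hcosφ : Real.cos φ ≠ 0 := (Real.cos_arctan_pos _).ne'
  have htan : Real.sqrt 7 = Real.tan φ := (Real.tan_arctan _).symm
  have hs1 : Real.sin (t + φ) ≠ 0 :=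
    (Real.sin_pos_of_pos_of_lt_pi (by linarith [Real.pi_pos]) (by linarith)).ne'
  have hs2 : Real.sin (t - φ) ≠ 0 := by
    rw [Ne, Real.sin_eq_zero_iff_of_lt_of_lt (by linarith) (by linarith), sub_eq_zero]
    exact htφ
  rw [htan, tan_add_div_tan_sub hcos hcosφ, abs_div,
    show |Real.sin (t + φ)| / |Real.sin (t - φ)| = |2 * Real.sin (t + φ)| / |2 * Real.sin (t - φ)|
      by rw [abs_mul, abs_mul, abs_two, mul_div_mul_left _ _ two_ne_zero],
    Real.log_div (abs_ne_zero.2 (mul_ne_zero two_ne_zero hs1))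
      (abs_ne_zero.2 (mul_ne_zero two_ne_zero hs2))]

/-- **The arctangent integral as Bloch–Wigner values** (Bailey et al. 2010, §5, p. 8: "the
equivalent identity (arctan) can be obtained by some reasonably straightforward but tedious
manipulation of the Clausen integral representation … and an appropriate change of variables"):
`∫_{π/3}^{π/2} log|(tan t + √7)/(tan t − √7)| dt = (3D(u) − 3D(u²) + D(u³))/6`, `u = e^{iα}`,
`α = 2 arctan √7`. [cite: BaileyEtAl2010, §5 eqs. (clausen)–(arctan) and (15)] -/
theorem integral_log_tan_sqrt_seven :
    ∫ t in (π / 3)..(π / 2), Real.log |(Real.tan t + Real.sqrt 7) / (Real.tan t - Real.sqrt 7)| =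
      (3 * blochWignerDilog (Complex.exp ((2 * Real.arctan (Real.sqrt 7) : ℝ) * Complex.I)) -
        3 * blochWignerDilog (Complex.exp ((2 * Real.arctan (Real.sqrt 7) : ℝ) * Complex.I) ^ 2) +
        blochWignerDilog (Complex.exp ((2 * Real.arctan (Real.sqrt 7) : ℝ) * Complex.I) ^ 3)) /
        6 := by
  set φ := Real.arctan (Real.sqrt 7) with hφ
  set α : ℝ := 2 * φ with hα
  set u : ℂ := Complex.exp (α * Complex.I) with hu
  obtain ⟨hφ1, hφ2⟩ := arctan_sqrt_seven_bounds
  have hα1 : 2 * π / 3 < α := by rw [hα]; linarith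
  have hα2 : α < π := by rw [hα]; linarith
  -- Step 1: replace the integrand (a.e. on `(π/3, π/2]`, off the two points `π/2`, `φ`)
  have hae : ∀ᵐ t ∂volume, t ∈ Ι (π / 3) (π / 2) →
      Real.log |(Real.tan t + Real.sqrt 7) / (Real.tan t - Real.sqrt 7)| =
        Real.log |2 * Real.sin (t + φ)| - Real.log |2 * Real.sin (t - φ)| := by
    have hnull : ∀ᵐ t ∂volume, t ∉ ({π / 2, φ} : Set ℝ) :=
      measure_eq_zero_iff_ae_notMem.1 ((Set.toFinite _).measure_zero volume)
    refine hnull.mono fun t ht hmem => ?_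
    simp only [mem_insert_iff, mem_singleton_iff, not_or] at ht
    rw [uIoc_of_le (by linarith [Real.pi_pos])] at hmem
    exact log_tan_sqrt_seven_eq hmem.1 (lt_of_le_of_ne hmem.2 ht.1) ht.2
  rw [intervalIntegral.integral_congr_ae hae, intervalIntegral.integral_sub
    (by simpa using intervalIntegrable_log_abs_two_sin 1 φ (π / 3) (π / 2))
    (by simpa [sub_eq_add_neg] using intervalIntegrable_log_abs_two_sin 1 (-φ) (π / 3) (π / 2))]
  -- Step 2: the two Clausen integrals by the substitution `v = 2t ± α`
  have hplus : ∫ t in (π / 3)..(π / 2), Real.log |2 * Real.sin (t + φ)| =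
      2⁻¹ * (blochWignerDilog (Complex.exp ((2 * π / 3 + α : ℝ) * Complex.I)) -
        blochWignerDilog (Complex.exp ((π + α : ℝ) * Complex.I))) := by
    have hsub := intervalIntegral.integral_comp_mul_add (a := π / 3) (b := π / 2)
      (fun v : ℝ => Real.log |2 * Real.sin (v / 2)|) two_ne_zero α
    have hfun : (fun t : ℝ => Real.log |2 * Real.sin ((2 * t + α) / 2)|) =
        fun t : ℝ => Real.log |2 * Real.sin (t + φ)| := by
      funext t; congr 3; rw [hα]; ring
    rw [hfun] at hsub
    rw [hsub, integral_log_abs_two_sin_half_eq_sub (by linarith [Real.pi_pos]) (by linarith)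
      (by linarith [Real.pi_pos]) (by linarith), smul_eq_mul]
    congr 2 <;> congr 2 <;> push_cast <;> ring
  have hminus : ∫ t in (π / 3)..(π / 2), Real.log |2 * Real.sin (t - φ)| =
      2⁻¹ * (blochWignerDilog (Complex.exp ((2 * π / 3 - α : ℝ) * Complex.I)) -
        blochWignerDilog (Complex.exp ((π - α : ℝ) * Complex.I))) := by
    have hsub := intervalIntegral.integral_comp_mul_add (a := π / 3) (b := π / 2)
      (fun v : ℝ => Real.log |2 * Real.sin (v / 2)|) two_ne_zero (-α)
    have hfun : (fun t : ℝ => Real.log |2 * Real.sin ((2 * t + -α) / 2)|) =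
        fun t : ℝ => Real.log |2 * Real.sin (t - φ)| := by
      funext t; congr 3; rw [hα]; ring
    rw [hfun] at hsub
    rw [hsub, integral_log_abs_two_sin_half_eq_sub (by linarith [Real.pi_pos]) (by linarith [Real.pi_pos])
      (by linarith [Real.pi_pos]) (by linarith [Real.pi_pos]), smul_eq_mul]
    congr 2 <;> congr 2 <;> push_cast <;> ring
  rw [hplus, hminus]
  -- Step 3: identify the four points as `ωu`, `−u`, `ω ū`, `−ū` and use `D(w̄) = −D(w)`
  set ω : ℂ := Complex.exp ((2 * π / 3 : ℝ) * Complex.I) with hω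
  have hω3 : ω ^ 3 = 1 := by
    rw [hω, ← Complex.exp_nat_mul, show ((3 : ℕ) : ℂ) * ((2 * π / 3 : ℝ) * Complex.I) =
      2 * π * Complex.I by push_cast; ring, Complex.exp_two_pi_mul_I]
  have hω1 : ω ≠ 1 := by
    rw [hω]
    refine exp_mul_I_ne_one ?_
    rw [show (2 * π / 3 : ℝ) / 2 = π / 3 by ring]
    exact (Real.sin_pos_of_pos_of_lt_pi (by positivity) (by linarith [Real.pi_pos])).ne'
  have hωconj : conj ω = ω ^ 2 := by
    rw [hω, ← Complex.exp_conj, ← Complex.exp_nat_mul, map_mul, Complex.conj_ofReal, Complex.conj_I]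
    rw [show ((2 * π / 3 : ℝ) : ℂ) * -Complex.I = ((2 : ℕ) : ℂ) * ((2 * π / 3 : ℝ) * Complex.I) -
      2 * π * Complex.I by push_cast; ring, Complex.exp_sub, Complex.exp_two_pi_mul_I, div_one]
  have e1 : Complex.exp ((2 * π / 3 + α : ℝ) * Complex.I) = ω * u := by
    rw [hω, hu, ← Complex.exp_add]; push_cast; ring_nf
  have e2 : Complex.exp ((π + α : ℝ) * Complex.I) = -u := by
    rw [hu, show ((π + α : ℝ) : ℂ) * Complex.I = π * Complex.I + α * Complex.I by push_cast; ring,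
      Complex.exp_add, Complex.exp_pi_mul_I]; ring
  have e3 : Complex.exp ((2 * π / 3 - α : ℝ) * Complex.I) = conj (ω ^ 2 * u) := by
    rw [map_mul, map_pow, hωconj, ← pow_mul, show 2 * 2 = 3 + 1 by norm_num, pow_add, hω3, one_mul,
      pow_one, hω, hu, ← Complex.exp_conj, ← Complex.exp_add, map_mul, Complex.conj_ofReal,
      Complex.conj_I]
    push_cast; ring_nf
  have e4 : Complex.exp ((π - α : ℝ) * Complex.I) = conj (-u) := by
    rw [map_neg, hu, ← Complex.exp_conj, map_mul, Complex.conj_ofReal, Complex.conj_I,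
      show ((π - α : ℝ) : ℂ) * Complex.I = π * Complex.I + (α : ℂ) * -Complex.I by push_cast; ring,
      Complex.exp_add, Complex.exp_pi_mul_I]; ring
  rw [e1, e2, e3, e4, blochWignerDilog_conj', blochWignerDilog_conj']
  -- Step 4: duplication and triplication
  have hdup := blochWignerDilog_sq u
  have htrip := blochWignerDilog_cube u hω3 hω1
  linarith

end Literature.NumberTheory.Transcendental
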